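import Summits.QuantumFields.YangMills.Theorems.BalabanUVNodesN13Cor3HistoryCountAtRecord13CoPH
import Summits.QuantumFields.YangMills.Theorems.BalabanUVNodesN13UVRowOfUpperAndSmallLocus
import Literature.MathematicalPhysics.QuantumFieldTheory.Balaban1983to89.B16RLeafRecord13SepCoPHSelLaws

/-!
# BalabanUVNodes ∕ N13 — THE JUNCTION AT K1⁷'s LITERAL DATUM: the engine row `hUV` and `B16.EndStatementBPrinted ((datumOfRecord₁₃SepCoPH θ h).C)` FROM N11's T-ROW + [IV] p.177
# SELECTOR LAWS (row `hR`'s by-name closer, dag-n13-w1 g0 p583899) + ONE PER-LAST-REGION ESTIMATE (U1_Z) (the (0.2)-currency upper half, p601317 ∕ p602004) + THE SMALL-LOCUS LOWER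
# BOUND (L2ˢ) (dag-n13-w1 g2 p593634 ∕ p595529) — every node-external input displayed BY NAME, the leaves (H) ∕ (U2) ∕ (L1) and the large-field lower half GONE (Track A, DAG node
# N13 = [B16]; cluster K1 — K1⁷ `StabilityBAtRecordR13SepCoPH` = stmt-QuantumFields-20542, helper; seat `pub-ymgap-dag-n13-w3` g2, CLAIM-2; 2026-08-28; count-neutral)

HONEST FRAMING.  Count-neutral COMPOSITION BY NAME of landed theorems; nothing of Bałaban's is asserted.  DISPLAYED (not proved): N11's T-row «`SLaw₁₃CoPH θ P k → TLaw₁₃CoPH θ P k`,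
`k < K`» on the window ([III] Theorem p.245 = N11's analysis), the selector laws (i) idempotent ∕ (ii) moves only dead sequences of [IV] p.177 for every windowed run (inhabited by the
identity and by node00-def-T's live selector, p583899 §3), admissibility and the three term-constant signs, the per-last-region small factor (U1_Z) «`ρ_k(Z,V) ≤ e^{a0(g_k)|T₁^{(k)}|}·
xf(g_k)^{#𝐃_k-cubes meeting Z}`» with `0 ≤ xf`, `a0 + xf ≤ e₊` ([IV] (1.1) ∕ [V] (1.89)-type — Bałaban's 𝐑-operation bounds), the all-small history's lower bound (L2ˢ) AT SMALL
CONFIGURATIONS ONLY ([III] Thm 2 ∕ (2.49) at the record read at the all-small history — dag-n13-w1's located form), and dag-n13-w1's numeric side conditions `hε hε3 hε2` on `εreg`.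
PROVED ∕ DISCHARGED along the way (by the cited files): Theorem 1's induction at the datum (p583899), the (2.18) representation (H) (def-T), the count (U2) (p601317), history-wise
non-negativity (L1) (p593634 `histTerm_nonneg`), the lower half at LARGE configurations (p593634 `uvLower_of_smallLocus`: a `b₀`-free plaquette off the small locus kills `χβ_k`).
N11 ∕ N13 NOT discharged; [III] Cor 3 ∕ [B16] Thm 1 NOT proved; K0⁷ ∕ K1⁷ NOT closed (K1⁷'s ∃θ ∕ guard ∕ admissibility ∕ window are elsewhere); counts unmoved (discharged 5∕27 ·
Track A 5∕28).  ONE finite four-torus programme at fixed `ε = L^{−K}`; R4 closes the conditional finite-𝕋⁴ rung `BalabanLadder.UV` only — the Yang–Mills mass gap (Clay) is NOT proved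
by any of this; nothing continuum ∕ ℝ⁴ ∕ OS.  No `sorry`, `def`, `instance`, `notation`.

WHAT THIS FILE PROVES.
§1 ★ `hUV₁₃CoPH_of_pieceBounds_L2small` — n24-c's ENGINE ROW `hUV` (module 36's `hUV13` ∕ `N24…_pointed`'s `hUV`, `WorldP` letters) from (U1_Z) + (L2ˢ) + `hε hε3 hε2`
   (dag-n13-w1's `hUV₁₃_of_upper_of_lowerSmallLocus` with the upper half SUPPLIED by p601317's `densOfRecord₁₃_le_of_pieceBound_siteUnits`).
§2 ★★ `cor3With_datumOfRecord₁₃CoPH_of_pieceBounds_L2small` — [III] Cor 3 «with e±» at the Co datum from Theorem 1's conclusion `hS` + (U1_Z) + (L2ˢ) (lower half at EVERY `V` by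
   `uvLower_of_smallLocus`), `cor3_250_datumOfRecord₁₃CoPH_of_thm1_of_pieceBounds_L2small` (the `min γ γ₁` logic).
§3 ★★★ `endStatementBPrinted_datumOfRecord₁₃SepCoPH_of_thm1_of_pieceBounds_L2small` (K1⁷'s (B) at its literal datum from Theorem 1 there + (U1_Z) + (L2ˢ)) and
   ★★★ `endStatementBPrinted_datumOfRecord₁₃SepCoPH_of_tRow_selLaws_pieceBounds_L2small` (the same with Theorem 1 PRODUCED by p583899 from N11's T-row + selector laws +
   admissibility + signs) — ONE statement of what the (B) conjunct of `StabilityBAtRecordR13SepCoPH` costs at `datumOfRecord₁₃SepCoPH θ h`.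

Sources: [Balaban1989LargeFieldII] Thm 1 p.355, (0.1) pp.355–356, p.391; [Balaban1988Convergent] Theorem p.245, Thm 1 p.262, Thm 2 (2.49) p.263, Cor. 3 (2.50) p.264;
[Balaban1989LargeFieldI] (0.2) p.176, (i)–(ii) p.177; [Balaban1985Averaging] Prop. 2 p.22 (via p593634, cite only).
-/

noncomputable section

open MeasureTheory
open scoped BigOperators Matrix.Norms.L2Operator

namespace Summit.QuantumFields.YangMills.BalabanUVNodes.N13EndStatementBOfTRowAndPieceBoundsAtRecord13SepCoPH

open Literature.MathematicalPhysics.QuantumFieldTheory.Balaban1983to89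
open T4Continuum Node00 B14.Eq218Concrete
open FlowStepRuns (genFlow)
open DagBinding (WorldP)
open ExpMeanLog (deltaSU)
open B16NodeKnitRecord13CoPH (uvIneq_at_record₁₃CoPH_iff)
open B14Cor3 (inInterval_of_le)
open B16RLeafRecord13SepCoPHSelLaws (thm1Printed_datumOfRecord₁₃SepCoPH_of_laws_of_selLaws)
open Summit.QuantumFields.YangMills.BalabanUVNodes.N13Cor3Repr218LeavesAtRecord13CoPH (densOfRecord₁₃_eq_sum sLaw₁₃CoPH_of_thm1)
open Summit.QuantumFields.YangMills.BalabanUVNodes.N13UVChiOffSolvableAtRecord13 (histTerm_nonneg uvLower_of_smallLocus)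
open Summit.QuantumFields.YangMills.BalabanUVNodes.N13UVRowOfUpperAndSmallLocus (hUV₁₃_of_upper_of_lowerSmallLocus)
open Summit.QuantumFields.YangMills.BalabanUVNodes.N13Cor3LastRegionCountAtRecord13CoPH (densOfRecord₁₃_le_of_pieceBound_siteUnits)

variable (F : T4Family) (N : ℕ) [NeZero N]

/-! ## §1. n24-c's engine row `hUV` from (U1_Z) + (L2ˢ) -/

section Row

variable (θ : Stage13HParams F N) (w : WorldP)

open Classical in
/-- **★ THE K1⁷ ENGINES' ROW `hUV` IN THE (0.2) CURRENCY**: for every run in `]0, w.γ]`, every `k ≤ K` with `SLaw₁₃CoPH θ P k` and every configuration, the two-sided (UV₁₃) bound on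
`densOfRecord₁₃` with the world's `w.em`, `w.ep` — from (U1_Z) (per-last-region small factor, per-step data `xf ≥ 0`, `a0`, `a0 + xf ≤ w.ep`) and (L2ˢ) (the all-small history `s₀`'s
lower bound at configurations all of whose `b₀`-free plaquettes are `(2εreg + 4ε₂₉)`-small), under dag-n13-w1's side conditions `hε hε3 hε2`; upper half by p601317, history-wise
non-negativity by `histTerm_nonneg`, large configurations by `hUV₁₃_of_upper_of_lowerSmallLocus`.  CONDITIONAL on (U1_Z), (L2ˢ); nothing of Bałaban's asserted.
[cite: Balaban1988Convergent, Cor. 3 (2.50) p.264; Balaban1989LargeFieldI, (0.2) p.176; Balaban1989LargeFieldII, (0.1) p.356 (bookkeeping)] -/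
theorem hUV₁₃CoPH_of_pieceBounds_L2small (h : θ.Provisos₁₃CoPH F N) (hε : 0 < θ.ν.εreg) (hε3 : (143 * ((((4 + 4 : ℕ) : ℝ)) ^ 2 / 4) ^ 2) * θ.ν.εreg ≤ 1 / 3)
    (hε2 : 2 * θ.ν.εreg ≤ 2 * deltaSU (Fin N) / ((((4 + 4) * F.L : ℕ) : ℝ) ^ 2)) (xf a0 : ℝ → ℝ) (hx : ∀ g, 0 ≤ xf g) (hep : ∀ g, a0 g + xf g ≤ w.ep g)
    (s₀ : (P : B12.RunParams) → (k : ℕ) → (reprOfRecord₁₃ F N θ.toStage13Params P k).Adm)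
    (hU1Z : ∀ P : B12.RunParams, (genFlow (betaOfRecord₁₃ F N θ.toStage13Params) P.g0).InInterval w.γ P.K → ∀ k, k ≤ P.K → SLaw₁₃CoPH F N θ P k →
      ∀ Z : Set (Site (F.P P.K) 0), Zᶜ ∈ DOfRecord F θ.ν θ.τ9.M (gOfRecord₁₃ F N θ.toStage13Params P) P.K k →
      ∀ V : GaugeField (F.P P.K) k (SU N), pieceOfRecord F N θ.ν θ.τ9.M
        (slotsOfRecord F N θ.ν θ.τ9 (EOfRecord₁₃ F N θ.toStage13Params) (wOfRecord₉ F N θ.toStage9Params) θ.ppSel)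
        P (gOfRecord₁₃ F N θ.toStage13Params P) k Z V ≤
        Real.exp (a0 (gOfRecord₁₃ F N θ.toStage13Params P k) * (Fintype.card (Site (F.P P.K) k) : ℝ)) *
          xf (gOfRecord₁₃ F N θ.toStage13Params P k) ^ Set.ncard {c | c ∈ cubeIndices (F.P P.K) (dCubeSide (F.P P.K).L θ.τ9.M
            (RkOfRecord (F.P P.K).L θ.ν.r (gOfRecord₁₃ F N θ.toStage13Params P k)) k) ∧
          ¬ cubeEnl (F.P P.K) (dCubeSide (F.P P.K).L θ.τ9.M (RkOfRecord (F.P P.K).L θ.ν.r (gOfRecord₁₃ F N θ.toStage13Params P k)) k) c 0 ⊆ Zᶜ})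
    (hL2small : ∀ P : B12.RunParams, (genFlow (betaOfRecord₁₃ F N θ.toStage13Params) P.g0).InInterval w.γ P.K → ∀ k, k ≤ P.K → SLaw₁₃CoPH F N θ P k →
      ∀ V : GaugeField (F.P P.K) k (SU N),
        (∀ p : Plaq (F.P P.K) k, ¬ IsB0 (F := F) (⟨p.src, p.μ⟩ : PBond (F.P P.K) k) → ¬ IsB0 (F := F) (⟨p.src.shift p.μ, p.ν⟩ : PBond (F.P P.K) k) →
          ¬ IsB0 (F := F) (⟨p.src.shift p.ν, p.μ⟩ : PBond (F.P P.K) k) → ¬ IsB0 (F := F) (⟨p.src, p.ν⟩ : PBond (F.P P.K) k) →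
          dist1 (GaugeField.plaqHol V p) < 2 * θ.ν.εreg + 4 * θ.ε₂₉) →
        chiβOfRecord₁₃ F N θ.toStage13Params P.K (gOfRecord₁₃ F N θ.toStage13Params P) k V *
            Real.exp (-(1 / (gOfRecord₁₃ F N θ.toStage13Params P k) ^ 2 * wilsonBGOfRecord F N θ.εbg P k V)
              - w.em (gOfRecord₁₃ F N θ.toStage13Params P k) * (Fintype.card (Site (F.P P.K) k) : ℝ)) ≤
          (reprOfRecord₁₃ F N θ.toStage13Params P k).χ (s₀ P k) V * (reprOfRecord₁₃ F N θ.toStage13Params P k).TexpA (s₀ P k) V) :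
    ∀ P : B12.RunParams, (genFlow (betaOfRecord₁₃ F N θ.toStage13Params) P.g0).InInterval w.γ P.K → ∀ k, k ≤ P.K → SLaw₁₃CoPH F N θ P k →
      ∀ U : GaugeField (F.P P.K) k (SU N),
        chiβOfRecord₁₃ F N θ.toStage13Params P.K (gOfRecord₁₃ F N θ.toStage13Params P) k U *
              Real.exp (-(1 / (gOfRecord₁₃ F N θ.toStage13Params P k) ^ 2 * wilsonBGOfRecord F N θ.toStage13Params.εbg P k U)
                - w.em (gOfRecord₁₃ F N θ.toStage13Params P k) * (Fintype.card (Site (F.P P.K) k) : ℝ)) ≤ densOfRecord₁₃ F N θ.toStage13Params P k U ∧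
        densOfRecord₁₃ F N θ.toStage13Params P k U ≤ Real.exp (w.ep (gOfRecord₁₃ F N θ.toStage13Params P k) * (Fintype.card (Site (F.P P.K) k) : ℝ)) :=
  hUV₁₃_of_upper_of_lowerSmallLocus θ h w hε hε3 hε2
    (fun P hP k hk hS U => densOfRecord₁₃_le_of_pieceBound_siteUnits F N θ P k hk (hx _) (a0 _) (w.ep _) (hep _) (hU1Z P hP k hk hS) U)
    (fun P hP k hk hS U hsmall =>
      B14Cor3.ge_of_sum_repr
        (fun s => (reprOfRecord₁₃ F N θ.toStage13Params P k).χ s U * (reprOfRecord₁₃ F N θ.toStage13Params P k).TexpA s U) (s₀ P k)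
        (densOfRecord₁₃_eq_sum F N θ P k U) (fun s => histTerm_nonneg θ.toStage13Params h.zetaUnity h.zetaAbs P k s U) (hL2small P hP k hk hS U hsmall))

end Row

/-! ## §2. [III] Cor 3 at the Co datum from Theorem 1's conclusion + (U1_Z) + (L2ˢ): the lower half at EVERY configuration by `uvLower_of_smallLocus` -/

section Family

variable (θ : Stage13HParams F N) (h : θ.Provisos₁₃CoPH F N)

open Classical in
/-- **★★ [III] COR. 3 «WITH e±» AT THE RECORD FROM THEOREM 1's CONCLUSION + (U1_Z) + (L2ˢ)**: at every windowed run and every `k ≤ K` with `SLaw₁₃CoPH θ P k`, `B16.UVIneq … V (em g_k) (ep g_k)`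
at EVERY configuration — the upper half from (U1_Z) (p601317, site units, `a0 + xf ≤ ep`), the lower half from (L2ˢ) at small configurations (`B14Cor3.ge_of_sum_repr` + `histTerm_nonneg`)
extended to all configurations by dag-n13-w1's `uvLower_of_smallLocus` (a `b₀`-free plaquette off the small locus kills `χβ_k`; side conditions `hε hε3 hε2`).  CONDITIONAL on `hS`,
(U1_Z), (L2ˢ); nothing of Bałaban's asserted. [cite: Balaban1988Convergent, Thm 1 p.262, Cor. 3 (2.50) p.264; Balaban1989LargeFieldI, (0.2) p.176] -/
theorem cor3With_datumOfRecord₁₃CoPH_of_pieceBounds_L2small (hε : 0 < θ.ν.εreg) (hε3 : (143 * ((((4 + 4 : ℕ) : ℝ)) ^ 2 / 4) ^ 2) * θ.ν.εreg ≤ 1 / 3)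
    (hε2 : 2 * θ.ν.εreg ≤ 2 * deltaSU (Fin N) / ((((4 + 4) * F.L : ℕ) : ℝ) ^ 2)) (γ : ℝ) (em ep xf a0 : ℝ → ℝ) (hx : ∀ g, 0 ≤ xf g)
    (hep : ∀ g, a0 g + xf g ≤ ep g) (s₀ : (P : B12.RunParams) → (k : ℕ) → (reprOfRecord₁₃ F N θ.toStage13Params P k).Adm)
    (hS : ∀ P : B12.RunParams, ((datumOfRecord₁₃CoPH F N θ h).C P).flow.InInterval γ P.K → ∀ k, k ≤ P.K → SLaw₁₃CoPH F N θ P k)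
    (hU1Z : ∀ P : B12.RunParams, ((datumOfRecord₁₃CoPH F N θ h).C P).flow.InInterval γ P.K → ∀ k, k ≤ P.K → SLaw₁₃CoPH F N θ P k →
      ∀ Z : Set (Site (F.P P.K) 0), Zᶜ ∈ DOfRecord F θ.ν θ.τ9.M (gOfRecord₁₃ F N θ.toStage13Params P) P.K k →
      ∀ V : GaugeField (F.P P.K) k (SU N), pieceOfRecord F N θ.ν θ.τ9.M
        (slotsOfRecord F N θ.ν θ.τ9 (EOfRecord₁₃ F N θ.toStage13Params) (wOfRecord₉ F N θ.toStage9Params) θ.ppSel)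
        P (gOfRecord₁₃ F N θ.toStage13Params P) k Z V ≤
        Real.exp (a0 (gOfRecord₁₃ F N θ.toStage13Params P k) * (Fintype.card (Site (F.P P.K) k) : ℝ)) *
          xf (gOfRecord₁₃ F N θ.toStage13Params P k) ^ Set.ncard {c | c ∈ cubeIndices (F.P P.K) (dCubeSide (F.P P.K).L θ.τ9.M
            (RkOfRecord (F.P P.K).L θ.ν.r (gOfRecord₁₃ F N θ.toStage13Params P k)) k) ∧
          ¬ cubeEnl (F.P P.K) (dCubeSide (F.P P.K).L θ.τ9.M (RkOfRecord (F.P P.K).L θ.ν.r (gOfRecord₁₃ F N θ.toStage13Params P k)) k) c 0 ⊆ Zᶜ})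
    (hL2small : ∀ P : B12.RunParams, ((datumOfRecord₁₃CoPH F N θ h).C P).flow.InInterval γ P.K → ∀ k, k ≤ P.K → SLaw₁₃CoPH F N θ P k →
      ∀ V : GaugeField (F.P P.K) k (SU N),
        (∀ p : Plaq (F.P P.K) k, ¬ IsB0 (F := F) (⟨p.src, p.μ⟩ : PBond (F.P P.K) k) → ¬ IsB0 (F := F) (⟨p.src.shift p.μ, p.ν⟩ : PBond (F.P P.K) k) →
          ¬ IsB0 (F := F) (⟨p.src.shift p.ν, p.μ⟩ : PBond (F.P P.K) k) → ¬ IsB0 (F := F) (⟨p.src, p.ν⟩ : PBond (F.P P.K) k) →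
          dist1 (GaugeField.plaqHol V p) < 2 * θ.ν.εreg + 4 * θ.ε₂₉) →
        chiβOfRecord₁₃ F N θ.toStage13Params P.K (gOfRecord₁₃ F N θ.toStage13Params P) k V *
            Real.exp (-(1 / (gOfRecord₁₃ F N θ.toStage13Params P k) ^ 2 * wilsonBGOfRecord F N θ.εbg P k V)
              - em (gOfRecord₁₃ F N θ.toStage13Params P k) * (Fintype.card (Site (F.P P.K) k) : ℝ)) ≤
          (reprOfRecord₁₃ F N θ.toStage13Params P k).χ (s₀ P k) V * (reprOfRecord₁₃ F N θ.toStage13Params P k).TexpA (s₀ P k) V) :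
    B16.Cor3With (datumOfRecord₁₃CoPH F N θ h).C γ em ep := by
  intro P hP k hk V
  have hs : SLaw₁₃CoPH F N θ P k := hS P hP k hk
  have hk' : k ≤ (F.P P.K).m + (F.P P.K).K := hk.trans (Nat.le_add_left _ _)
  refine (uvIneq_at_record₁₃CoPH_iff F N θ h P k V _ _).2 ⟨?_, densOfRecord₁₃_le_of_pieceBound_siteUnits F N θ P k hk (hx _) (a0 _) (ep _) (hep _) (hU1Z P hP k hk hs) V⟩
  exact uvLower_of_smallLocus θ.toStage13Params h.zetaUnity h.zetaAbs hε P hk' hε3 hε2 _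
    (fun U hsmall => B14Cor3.ge_of_sum_repr
      (fun s => (reprOfRecord₁₃ F N θ.toStage13Params P k).χ s U * (reprOfRecord₁₃ F N θ.toStage13Params P k).TexpA s U) (s₀ P k)
      (densOfRecord₁₃_eq_sum F N θ P k U) (fun s => histTerm_nonneg θ.toStage13Params h.zetaUnity h.zetaAbs P k s U) (hL2small P hP k hk hs U hsmall)) V

open Classical in
/-- **★★ [III] COR. 3 (`B16.Cor3_250`) AT THE RECORD FROM THEOREM 1 AT THE RECORD + (U1_Z) + (L2ˢ) ON `]0, γ]`** (adv3's `min γ γ₁` logic through g0's `sLaw₁₃CoPH_of_thm1`).  CONDITIONAL;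
nothing of Bałaban's asserted. [cite: Balaban1988Convergent, Cor. 3 (2.50) p.264; Balaban1989LargeFieldII, Thm 1 p.355] -/
theorem cor3_250_datumOfRecord₁₃CoPH_of_thm1_of_pieceBounds_L2small (hε : 0 < θ.ν.εreg) (hε3 : (143 * ((((4 + 4 : ℕ) : ℝ)) ^ 2 / 4) ^ 2) * θ.ν.εreg ≤ 1 / 3)
    (hε2 : 2 * θ.ν.εreg ≤ 2 * deltaSU (Fin N) / ((((4 + 4) * F.L : ℕ) : ℝ) ^ 2)) (γ : ℝ) (hγ : 0 < γ) (em ep xf a0 : ℝ → ℝ) (hx : ∀ g, 0 ≤ xf g)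
    (hep : ∀ g, a0 g + xf g ≤ ep g) (s₀ : (P : B12.RunParams) → (k : ℕ) → (reprOfRecord₁₃ F N θ.toStage13Params P k).Adm)
    (h1 : B16.Thm1Printed (datumOfRecord₁₃CoPH F N θ h).C)
    (hU1Z : ∀ P : B12.RunParams, ((datumOfRecord₁₃CoPH F N θ h).C P).flow.InInterval γ P.K → ∀ k, k ≤ P.K → SLaw₁₃CoPH F N θ P k →
      ∀ Z : Set (Site (F.P P.K) 0), Zᶜ ∈ DOfRecord F θ.ν θ.τ9.M (gOfRecord₁₃ F N θ.toStage13Params P) P.K k →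
      ∀ V : GaugeField (F.P P.K) k (SU N), pieceOfRecord F N θ.ν θ.τ9.M
        (slotsOfRecord F N θ.ν θ.τ9 (EOfRecord₁₃ F N θ.toStage13Params) (wOfRecord₉ F N θ.toStage9Params) θ.ppSel)
        P (gOfRecord₁₃ F N θ.toStage13Params P) k Z V ≤
        Real.exp (a0 (gOfRecord₁₃ F N θ.toStage13Params P k) * (Fintype.card (Site (F.P P.K) k) : ℝ)) *
          xf (gOfRecord₁₃ F N θ.toStage13Params P k) ^ Set.ncard {c | c ∈ cubeIndices (F.P P.K) (dCubeSide (F.P P.K).L θ.τ9.M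
            (RkOfRecord (F.P P.K).L θ.ν.r (gOfRecord₁₃ F N θ.toStage13Params P k)) k) ∧
          ¬ cubeEnl (F.P P.K) (dCubeSide (F.P P.K).L θ.τ9.M (RkOfRecord (F.P P.K).L θ.ν.r (gOfRecord₁₃ F N θ.toStage13Params P k)) k) c 0 ⊆ Zᶜ})
    (hL2small : ∀ P : B12.RunParams, ((datumOfRecord₁₃CoPH F N θ h).C P).flow.InInterval γ P.K → ∀ k, k ≤ P.K → SLaw₁₃CoPH F N θ P k →
      ∀ V : GaugeField (F.P P.K) k (SU N),
        (∀ p : Plaq (F.P P.K) k, ¬ IsB0 (F := F) (⟨p.src, p.μ⟩ : PBond (F.P P.K) k) → ¬ IsB0 (F := F) (⟨p.src.shift p.μ, p.ν⟩ : PBond (F.P P.K) k) →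
          ¬ IsB0 (F := F) (⟨p.src.shift p.ν, p.μ⟩ : PBond (F.P P.K) k) → ¬ IsB0 (F := F) (⟨p.src, p.ν⟩ : PBond (F.P P.K) k) →
          dist1 (GaugeField.plaqHol V p) < 2 * θ.ν.εreg + 4 * θ.ε₂₉) →
        chiβOfRecord₁₃ F N θ.toStage13Params P.K (gOfRecord₁₃ F N θ.toStage13Params P) k V *
            Real.exp (-(1 / (gOfRecord₁₃ F N θ.toStage13Params P k) ^ 2 * wilsonBGOfRecord F N θ.εbg P k V)
              - em (gOfRecord₁₃ F N θ.toStage13Params P k) * (Fintype.card (Site (F.P P.K) k) : ℝ)) ≤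
          (reprOfRecord₁₃ F N θ.toStage13Params P k).χ (s₀ P k) V * (reprOfRecord₁₃ F N θ.toStage13Params P k).TexpA (s₀ P k) V) :
    B16.Cor3_250 (datumOfRecord₁₃CoPH F N θ h).C := by
  obtain ⟨γ₁, hγ₁, H1⟩ := sLaw₁₃CoPH_of_thm1 F N θ h h1
  refine ⟨min γ γ₁, lt_min hγ hγ₁, em, ep, ?_⟩
  refine cor3With_datumOfRecord₁₃CoPH_of_pieceBounds_L2small F N θ h hε hε3 hε2 (min γ γ₁) em ep xf a0 hx hep s₀ ?_ ?_ ?_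
  · exact fun P hP k hk => H1 P (inInterval_of_le hP (min_le_right γ γ₁)) k hk
  · exact fun P hP => hU1Z P (inInterval_of_le hP (min_le_left γ γ₁))
  · exact fun P hP => hL2small P (inInterval_of_le hP (min_le_left γ γ₁))

end Family

/-! ## §3. K1⁷'s LITERAL DATUM `datumOfRecord₁₃SepCoPH θ h`: (B) from Theorem 1 there, and from N11's T-row + selector laws (p583899) -/

section SepCoPH

variable (θ : Stage13HParams F N) (h : θ.Provisos₁₃SepCoPH F N)

open Classical in
/-- **★★★ K1⁷'s (B) CONJUNCT AT ITS LITERAL DATUM FROM THEOREM 1 THERE + (U1_Z) + (L2ˢ)** — `B16.EndStatementBPrinted ((datumOfRecord₁₃SepCoPH θ h).C)` from `B16.Thm1Printed (…)` (N11 ∕ N13's 𝐑-row, a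
HYPOTHESIS), the per-last-region small factor (U1_Z) and the small-locus lower bound (L2ˢ) on `]0, γ]`, side conditions `hε hε3 hε2`; §2 at `h.toCore` along def-T's `rfl` bridge.  CONDITIONAL;
K1⁷ NOT closed; nothing of Bałaban's asserted. [cite: Balaban1989LargeFieldII, Thm 1 p.355, (0.1) pp.355–356; Balaban1988Convergent, Cor. 3 p.264; Balaban1989LargeFieldI, (0.2) p.176] -/
theorem endStatementBPrinted_datumOfRecord₁₃SepCoPH_of_thm1_of_pieceBounds_L2small (hε : 0 < θ.ν.εreg) (hε3 : (143 * ((((4 + 4 : ℕ) : ℝ)) ^ 2 / 4) ^ 2) * θ.ν.εreg ≤ 1 / 3)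
    (hε2 : 2 * θ.ν.εreg ≤ 2 * deltaSU (Fin N) / ((((4 + 4) * F.L : ℕ) : ℝ) ^ 2)) (γ : ℝ) (hγ : 0 < γ) (em ep xf a0 : ℝ → ℝ) (hx : ∀ g, 0 ≤ xf g)
    (hep : ∀ g, a0 g + xf g ≤ ep g) (s₀ : (P : B12.RunParams) → (k : ℕ) → (reprOfRecord₁₃ F N θ.toStage13Params P k).Adm)
    (h1 : B16.Thm1Printed (datumOfRecord₁₃SepCoPH F N θ h).C)
    (hU1Z : ∀ P : B12.RunParams, ((datumOfRecord₁₃SepCoPH F N θ h).C P).flow.InInterval γ P.K → ∀ k, k ≤ P.K → SLaw₁₃CoPH F N θ P k →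
      ∀ Z : Set (Site (F.P P.K) 0), Zᶜ ∈ DOfRecord F θ.ν θ.τ9.M (gOfRecord₁₃ F N θ.toStage13Params P) P.K k →
      ∀ V : GaugeField (F.P P.K) k (SU N), pieceOfRecord F N θ.ν θ.τ9.M
        (slotsOfRecord F N θ.ν θ.τ9 (EOfRecord₁₃ F N θ.toStage13Params) (wOfRecord₉ F N θ.toStage9Params) θ.ppSel)
        P (gOfRecord₁₃ F N θ.toStage13Params P) k Z V ≤
        Real.exp (a0 (gOfRecord₁₃ F N θ.toStage13Params P k) * (Fintype.card (Site (F.P P.K) k) : ℝ)) *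
          xf (gOfRecord₁₃ F N θ.toStage13Params P k) ^ Set.ncard {c | c ∈ cubeIndices (F.P P.K) (dCubeSide (F.P P.K).L θ.τ9.M
            (RkOfRecord (F.P P.K).L θ.ν.r (gOfRecord₁₃ F N θ.toStage13Params P k)) k) ∧
          ¬ cubeEnl (F.P P.K) (dCubeSide (F.P P.K).L θ.τ9.M (RkOfRecord (F.P P.K).L θ.ν.r (gOfRecord₁₃ F N θ.toStage13Params P k)) k) c 0 ⊆ Zᶜ})
    (hL2small : ∀ P : B12.RunParams, ((datumOfRecord₁₃SepCoPH F N θ h).C P).flow.InInterval γ P.K → ∀ k, k ≤ P.K → SLaw₁₃CoPH F N θ P k →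
      ∀ V : GaugeField (F.P P.K) k (SU N),
        (∀ p : Plaq (F.P P.K) k, ¬ IsB0 (F := F) (⟨p.src, p.μ⟩ : PBond (F.P P.K) k) → ¬ IsB0 (F := F) (⟨p.src.shift p.μ, p.ν⟩ : PBond (F.P P.K) k) →
          ¬ IsB0 (F := F) (⟨p.src.shift p.ν, p.μ⟩ : PBond (F.P P.K) k) → ¬ IsB0 (F := F) (⟨p.src, p.ν⟩ : PBond (F.P P.K) k) →
          dist1 (GaugeField.plaqHol V p) < 2 * θ.ν.εreg + 4 * θ.ε₂₉) →
        chiβOfRecord₁₃ F N θ.toStage13Params P.K (gOfRecord₁₃ F N θ.toStage13Params P) k V *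
            Real.exp (-(1 / (gOfRecord₁₃ F N θ.toStage13Params P k) ^ 2 * wilsonBGOfRecord F N θ.εbg P k V)
              - em (gOfRecord₁₃ F N θ.toStage13Params P k) * (Fintype.card (Site (F.P P.K) k) : ℝ)) ≤
          (reprOfRecord₁₃ F N θ.toStage13Params P k).χ (s₀ P k) V * (reprOfRecord₁₃ F N θ.toStage13Params P k).TexpA (s₀ P k) V) :
    B16.EndStatementBPrinted (datumOfRecord₁₃SepCoPH F N θ h).C :=
  ⟨h1, cor3_250_datumOfRecord₁₃CoPH_of_thm1_of_pieceBounds_L2small F N θ h.toCore hε hε3 hε2 γ hγ em ep xf a0 hx hep s₀ h1 hU1Z hL2small⟩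

open Classical in
/-- **★★★ ONE STATEMENT OF WHAT K1⁷'s (B) CONJUNCT COSTS AT ITS LITERAL DATUM, EVERY NODE-EXTERNAL INPUT BY NAME**: `B16.EndStatementBPrinted ((datumOfRecord₁₃SepCoPH F N θ h).C)` ⟸
admissibility `hθ` ∧ the three term-constant signs ∧ the selector laws of [IV] p.177 for every run ((i) `hidem` idempotent, (ii) `hdead` moves only dead sequences) ∧ N11's T-ROW «`SLaw₁₃CoPH θ P k →
TLaw₁₃CoPH θ P k`, `k < K`» on `]0, γ]` (these four give Theorem 1 at the datum BY dag-n13-w1 g0's `thm1Printed_datumOfRecord₁₃SepCoPH_of_laws_of_selLaws`, p583899) ∧ (U1_Z) the per-last-region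
small factor ([IV] (1.1) ∕ [V] (1.89)-type, per-step data `xf ≥ 0`, `a0`, `a0 + xf ≤ ep`) ∧ (L2ˢ) the all-small history's lower bound at small configurations ([III] Thm 2 ∕ (2.49) at the record) ∧
dag-n13-w1's side conditions `hε hε3 hε2`.  Leaves (H) ∕ (U2) ∕ (L1), the large-field lower half and Theorem 1's induction are theorems of the cited files.  CONDITIONAL on the displayed
inputs; K1⁷ NOT closed (its ∃θ ∕ guard ∕ admissibility-as-data ∕ window are K0⁷'s and the run-row files'); nothing of Bałaban's asserted.
[cite: Balaban1989LargeFieldII, Thm 1 p.355, (0.1) pp.355–356, p.391; Balaban1988Convergent, Theorem p.245, Thm 1 p.262, Cor. 3 p.264; Balaban1989LargeFieldI, (0.2) p.176, (i)–(ii) p.177] -/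
theorem endStatementBPrinted_datumOfRecord₁₃SepCoPH_of_tRow_selLaws_pieceBounds_L2small (hθ : θ.Admissible F N) (hκ : 0 ≤ θ.s2.lf.κ) (hE₀ : 0 ≤ θ.s2.lf.E₀)
    (hB₀ : 0 ≤ θ.s2.lf.B₀) (hε : 0 < θ.ν.εreg) (hε3 : (143 * ((((4 + 4 : ℕ) : ℝ)) ^ 2 / 4) ^ 2) * θ.ν.εreg ≤ 1 / 3)
    (hε2 : 2 * θ.ν.εreg ≤ 2 * deltaSU (Fin N) / ((((4 + 4) * F.L : ℕ) : ℝ) ^ 2)) (γ : ℝ) (hγ : 0 < γ) (em ep xf a0 : ℝ → ℝ) (hx : ∀ g, 0 ≤ xf g)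
    (hep : ∀ g, a0 g + xf g ≤ ep g) (s₀ : (P : B12.RunParams) → (k : ℕ) → (reprOfRecord₁₃ F N θ.toStage13Params P k).Adm)
    (hidem : ∀ (P : B12.RunParams) k, k < P.K → ∀ a, θ.ppSel P (gOfRecord₁₃ F N θ.toStage13Params P) (k + 1) (θ.ppSel P (gOfRecord₁₃ F N θ.toStage13Params P) (k + 1) a)
      = θ.ppSel P (gOfRecord₁₃ F N θ.toStage13Params P) (k + 1) a)
    (hdead : ∀ (P : B12.RunParams) k, k < P.K → ∀ a, θ.ppSel P (gOfRecord₁₃ F N θ.toStage13Params P) (k + 1) a ≠ a →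
      ∀ V, B15.BasicStep.fibreIntegral (fibOfSeq F θ.ν θ.τ9 P (gOfRecord₁₃ F N θ.toStage13Params P) (k + 1) a)
        (rterm (sliceOfRecord F N θ.ν θ.τ9.M P (gOfRecord₁₃ F N θ.toStage13Params P) (k + 1)
          (slotsTOfRecord F N θ.ν θ.τ9 (EOfRecord₁₃ F N θ.toStage13Params) (wOfRecord₉ F N θ.toStage9Params) θ.ppSel P (gOfRecord₁₃ F N θ.toStage13Params P) (k + 1))) a) V = 0)
    (hT : ∀ P : B12.RunParams, ((datumOfRecord₁₃SepCoPH F N θ h).C P).flow.InInterval γ P.K →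
      ∀ k, k < P.K → SLaw₁₃CoPH F N θ P k → TLaw₁₃CoPH F N θ P k)
    (hU1Z : ∀ P : B12.RunParams, ((datumOfRecord₁₃SepCoPH F N θ h).C P).flow.InInterval γ P.K → ∀ k, k ≤ P.K → SLaw₁₃CoPH F N θ P k →
      ∀ Z : Set (Site (F.P P.K) 0), Zᶜ ∈ DOfRecord F θ.ν θ.τ9.M (gOfRecord₁₃ F N θ.toStage13Params P) P.K k →
      ∀ V : GaugeField (F.P P.K) k (SU N), pieceOfRecord F N θ.ν θ.τ9.M
        (slotsOfRecord F N θ.ν θ.τ9 (EOfRecord₁₃ F N θ.toStage13Params) (wOfRecord₉ F N θ.toStage9Params) θ.ppSel)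
        P (gOfRecord₁₃ F N θ.toStage13Params P) k Z V ≤
        Real.exp (a0 (gOfRecord₁₃ F N θ.toStage13Params P k) * (Fintype.card (Site (F.P P.K) k) : ℝ)) *
          xf (gOfRecord₁₃ F N θ.toStage13Params P k) ^ Set.ncard {c | c ∈ cubeIndices (F.P P.K) (dCubeSide (F.P P.K).L θ.τ9.M
            (RkOfRecord (F.P P.K).L θ.ν.r (gOfRecord₁₃ F N θ.toStage13Params P k)) k) ∧
          ¬ cubeEnl (F.P P.K) (dCubeSide (F.P P.K).L θ.τ9.M (RkOfRecord (F.P P.K).L θ.ν.r (gOfRecord₁₃ F N θ.toStage13Params P k)) k) c 0 ⊆ Zᶜ})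
    (hL2small : ∀ P : B12.RunParams, ((datumOfRecord₁₃SepCoPH F N θ h).C P).flow.InInterval γ P.K → ∀ k, k ≤ P.K → SLaw₁₃CoPH F N θ P k →
      ∀ V : GaugeField (F.P P.K) k (SU N),
        (∀ p : Plaq (F.P P.K) k, ¬ IsB0 (F := F) (⟨p.src, p.μ⟩ : PBond (F.P P.K) k) → ¬ IsB0 (F := F) (⟨p.src.shift p.μ, p.ν⟩ : PBond (F.P P.K) k) →
          ¬ IsB0 (F := F) (⟨p.src.shift p.ν, p.μ⟩ : PBond (F.P P.K) k) → ¬ IsB0 (F := F) (⟨p.src, p.ν⟩ : PBond (F.P P.K) k) →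
          dist1 (GaugeField.plaqHol V p) < 2 * θ.ν.εreg + 4 * θ.ε₂₉) →
        chiβOfRecord₁₃ F N θ.toStage13Params P.K (gOfRecord₁₃ F N θ.toStage13Params P) k V *
            Real.exp (-(1 / (gOfRecord₁₃ F N θ.toStage13Params P k) ^ 2 * wilsonBGOfRecord F N θ.εbg P k V)
              - em (gOfRecord₁₃ F N θ.toStage13Params P k) * (Fintype.card (Site (F.P P.K) k) : ℝ)) ≤
          (reprOfRecord₁₃ F N θ.toStage13Params P k).χ (s₀ P k) V * (reprOfRecord₁₃ F N θ.toStage13Params P k).TexpA (s₀ P k) V) :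
    B16.EndStatementBPrinted (datumOfRecord₁₃SepCoPH F N θ h).C :=
  endStatementBPrinted_datumOfRecord₁₃SepCoPH_of_thm1_of_pieceBounds_L2small F N θ h hε hε3 hε2 γ hγ em ep xf a0 hx hep s₀
    (thm1Printed_datumOfRecord₁₃SepCoPH_of_laws_of_selLaws F N θ h hθ hκ hE₀ hB₀ hγ hidem hdead hT) hU1Z hL2small

end SepCoPH

/-! ## §4. (v1.1, append-only) N13's DAG NODE `Dag.B16_main (leavesP w P)` — the N13 entry of K1⁷ v6 stub 1's `Nodes (leavesP w P)` — from the selector laws + (U1_Z) + (L2ˢ) -/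

section Node

variable (θ : Stage13HParams F N) (w : WorldP) (P : B12.RunParams) (h : θ.Provisos₁₃CoPH F N)

open Classical in
/-- **★★★ N13's NODE PREDICATE AT A WORLD BOUND TO THE STAGE-13 RECORD, BOTH OF ITS ROWS BY NAME**: for `w.C = (datumOfRecord₁₃CoPH θ h).C` and `w.up P = upOfRecord₅C … (θ.toStage5₁₃CoPH) P`,
`Dag.B16_main (leavesP w P)` (module 36's `b16_main_at_record₁₃CoPH`) with (R₁₃) `hR13` SUPPLIED by dag-n13-w1 g0's `laws₁₃CoPH_of_selLaws_coPH` (p583899 §0: admissibility, the three term-constant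
signs, the [IV] p.177 selector laws (i) `hidem` ∕ (ii) `hdead` of the run) and (UV₁₃) `hUV13` SUPPLIED by §1's `hUV₁₃CoPH_of_pieceBounds_L2small` at `γ₁ := w.γ` ((U1_Z) per-last-region small factor with
`a0 + xf ≤ w.ep`, (L2ˢ) at small configurations, `hε hε3 hε2`).  This is the N13 conjunct of `Nodes (leavesP w P)` in K1⁷ v6 stub 1 `stub_nodes13PWS`, priced: [B16] Thm 1's 𝐑-operation
bounds enter ONLY through (U1_Z) ([IV] (1.1) ∕ [V] (1.89)) and [III] Thm 2 only through (L2ˢ); N11's T-row is NOT needed for the node itself (it is needed for Theorem 1, §3).  CONDITIONAL on the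
displayed inputs; N13 NOT discharged; nothing of Bałaban's asserted. [cite: Balaban1989LargeFieldII, Thm 1 p.355, (0.1) pp.355–356, p.387; Balaban1988Convergent, p.244, Cor. 3 p.264; Balaban1989LargeFieldI, (0.2) p.176, (i)–(ii) p.177] -/
theorem b16_main_at_record₁₃CoPH_of_selLaws_pieceBounds_L2small (hC : w.C = (datumOfRecord₁₃CoPH F N θ h).C)
    (hup : w.up P = upOfRecord₅C F N (θ.toStage5₁₃CoPH F N) P) (hθ : θ.Admissible F N) (hκ : 0 ≤ θ.s2.lf.κ) (hE₀ : 0 ≤ θ.s2.lf.E₀) (hB₀ : 0 ≤ θ.s2.lf.B₀)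
    (hidem : ∀ k, k < P.K → ∀ a, θ.ppSel P (gOfRecord₁₃ F N θ.toStage13Params P) (k + 1) (θ.ppSel P (gOfRecord₁₃ F N θ.toStage13Params P) (k + 1) a)
      = θ.ppSel P (gOfRecord₁₃ F N θ.toStage13Params P) (k + 1) a)
    (hdead : ∀ k, k < P.K → ∀ a, θ.ppSel P (gOfRecord₁₃ F N θ.toStage13Params P) (k + 1) a ≠ a →
      ∀ V, B15.BasicStep.fibreIntegral (fibOfSeq F θ.ν θ.τ9 P (gOfRecord₁₃ F N θ.toStage13Params P) (k + 1) a)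
        (rterm (sliceOfRecord F N θ.ν θ.τ9.M P (gOfRecord₁₃ F N θ.toStage13Params P) (k + 1)
          (slotsTOfRecord F N θ.ν θ.τ9 (EOfRecord₁₃ F N θ.toStage13Params) (wOfRecord₉ F N θ.toStage9Params) θ.ppSel P (gOfRecord₁₃ F N θ.toStage13Params P) (k + 1))) a) V = 0)
    (hε : 0 < θ.ν.εreg) (hε3 : (143 * ((((4 + 4 : ℕ) : ℝ)) ^ 2 / 4) ^ 2) * θ.ν.εreg ≤ 1 / 3) (hε2 : 2 * θ.ν.εreg ≤ 2 * deltaSU (Fin N) / ((((4 + 4) * F.L : ℕ) : ℝ) ^ 2))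
    (xf a0 : ℝ → ℝ) (hx : ∀ g, 0 ≤ xf g) (hep : ∀ g, a0 g + xf g ≤ w.ep g) (s₀ : (P : B12.RunParams) → (k : ℕ) → (reprOfRecord₁₃ F N θ.toStage13Params P k).Adm)
    (hU1Z : ∀ P : B12.RunParams, (genFlow (betaOfRecord₁₃ F N θ.toStage13Params) P.g0).InInterval w.γ P.K → ∀ k, k ≤ P.K → SLaw₁₃CoPH F N θ P k →
      ∀ Z : Set (Site (F.P P.K) 0), Zᶜ ∈ DOfRecord F θ.ν θ.τ9.M (gOfRecord₁₃ F N θ.toStage13Params P) P.K k →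
      ∀ V : GaugeField (F.P P.K) k (SU N), pieceOfRecord F N θ.ν θ.τ9.M
        (slotsOfRecord F N θ.ν θ.τ9 (EOfRecord₁₃ F N θ.toStage13Params) (wOfRecord₉ F N θ.toStage9Params) θ.ppSel)
        P (gOfRecord₁₃ F N θ.toStage13Params P) k Z V ≤
        Real.exp (a0 (gOfRecord₁₃ F N θ.toStage13Params P k) * (Fintype.card (Site (F.P P.K) k) : ℝ)) *
          xf (gOfRecord₁₃ F N θ.toStage13Params P k) ^ Set.ncard {c | c ∈ cubeIndices (F.P P.K) (dCubeSide (F.P P.K).L θ.τ9.M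
            (RkOfRecord (F.P P.K).L θ.ν.r (gOfRecord₁₃ F N θ.toStage13Params P k)) k) ∧
          ¬ cubeEnl (F.P P.K) (dCubeSide (F.P P.K).L θ.τ9.M (RkOfRecord (F.P P.K).L θ.ν.r (gOfRecord₁₃ F N θ.toStage13Params P k)) k) c 0 ⊆ Zᶜ})
    (hL2small : ∀ P : B12.RunParams, (genFlow (betaOfRecord₁₃ F N θ.toStage13Params) P.g0).InInterval w.γ P.K → ∀ k, k ≤ P.K → SLaw₁₃CoPH F N θ P k →
      ∀ V : GaugeField (F.P P.K) k (SU N),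
        (∀ p : Plaq (F.P P.K) k, ¬ IsB0 (F := F) (⟨p.src, p.μ⟩ : PBond (F.P P.K) k) → ¬ IsB0 (F := F) (⟨p.src.shift p.μ, p.ν⟩ : PBond (F.P P.K) k) →
          ¬ IsB0 (F := F) (⟨p.src.shift p.ν, p.μ⟩ : PBond (F.P P.K) k) → ¬ IsB0 (F := F) (⟨p.src, p.ν⟩ : PBond (F.P P.K) k) →
          dist1 (GaugeField.plaqHol V p) < 2 * θ.ν.εreg + 4 * θ.ε₂₉) →
        chiβOfRecord₁₃ F N θ.toStage13Params P.K (gOfRecord₁₃ F N θ.toStage13Params P) k V *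
            Real.exp (-(1 / (gOfRecord₁₃ F N θ.toStage13Params P k) ^ 2 * wilsonBGOfRecord F N θ.εbg P k V)
              - w.em (gOfRecord₁₃ F N θ.toStage13Params P k) * (Fintype.card (Site (F.P P.K) k) : ℝ)) ≤
          (reprOfRecord₁₃ F N θ.toStage13Params P k).χ (s₀ P k) V * (reprOfRecord₁₃ F N θ.toStage13Params P k).TexpA (s₀ P k) V) :
    Dag.B16_main (DagBinding.leavesP w P) :=
  B16NodeKnitRecord13CoPH.b16_main_at_record₁₃CoPH F N θ w P h hC hup
    (B16RLeafRecord13SepCoPHSelLaws.laws₁₃CoPH_of_selLaws_coPH F N θ P h hθ hκ hE₀ hB₀ hidem hdead) le_rfl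
    (hUV₁₃CoPH_of_pieceBounds_L2small F N θ w h hε hε3 hε2 xf a0 hx hep s₀ hU1Z hL2small P)

end Node

end Summit.QuantumFields.YangMills.BalabanUVNodes.N13EndStatementBOfTRowAndPieceBoundsAtRecord13SepCoPH

end
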